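import Mathlib
import HarnessLib
import Literature.Probability.MarkovChains.TotalVariation

/-!
# Eigenfunctions of simple random walk on the `n`-cycle: `f_j(k) = cos(2πjk/n)`, `λ_j = cos(2πj/n)` (Levin–Peres–Wilmer §12.3.1)

HONEST FRAMING: exact (Metropolis-corrected) sampling algorithms for lattice gauge theory; figures
of merit are autocorrelation/cost numbers at stated couplings and volumes; no continuum-physics claim.

Conventions of `TotalVariation.lean` (`IsRowStochastic`) and `MetropolisHastings.lean`
(`DetailedBalance`); the state space of the `n`-cycle is `ZMod n` (the book's multiplicative group
`W_n` of `n`-th roots of unity, `ω^k ↔ k`).  Source: D. A. Levin, Y. Peres (with E. L. Wilmer),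
*Markov Chains and Mixing Times*, 2nd ed., AMS 2017 [LevinPeres2017], §12.3.1 "The cycle",
pp. 165–166, eqs. (12.16)–(12.18) (with §1.4 Example 1.4 / §2.? for the walk itself).  Everything is
PROVED (finite sums and trigonometric identities; 0 named facts).

* `cycleWalk n` — simple random walk on the `n`-cycle, `P(k, k+1) = P(k, k−1) = ½`
  [cite: LevinPeres2017, §12.3.1 ("simple random walk on the `n`-cycle as the random walk on … `W_n`
  with increment distribution uniform on `{ω, ω⁻¹}`")]; `cycleWalk_mulVec` — `(Pf)(k) =
  [f(k−1) + f(k+1)]/2` (the display before (12.16)); `cycleWalk_isRowStochastic`, `cycleWalk_symm`,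
  `cycleWalk_detailedBalance_uniform`;
* `cycleEigenfun n j` — **eq. (12.18)** `f_j(ω^k) = cos(2πjk/n)` [cite: LevinPeres2017, §12.3.1
  eq. (12.18)];
* **EQS. (12.16)–(12.18)** `LevinPeres2017_eq_12_18` — **`P f_j = cos(2πj/n) f_j`**: `f_j` is an
  eigenfunction with eigenvalue `λ_j = cos(2πj/n)` [cite: LevinPeres2017, §12.3.1 eqs. (12.16)–(12.18)]
  (the book derives it for `φ_j(ω^k) = ω^{jk}` and takes real parts; here the real computation
  `cos(θ − b) + cos(θ + b) = 2cos(b)cos(θ)` is done directly);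
* `LevinPeres2017_cycle_even` — **when `n = 2m` is even, `−1` is an eigenvalue** (`f_m(k) = cos(πk) =
  (−1)^k`), "so `γ⋆ = 0`; the walk in this case is periodic" [cite: LevinPeres2017, §12.3.1 (last
  paragraph)].

NOT CLAIMED: that the `cos(2πj/n)` exhaust the spectrum, `λ₂ = cos(2π/n)` and the order `n⁻²` of the
spectral gap (these need the completeness of the `φ_j`).

Context (cell pub-lqcd, venture LatticeQCDFlow): the `n`-cycle is the configuration space of a
single `ℤ_n` link / clock variable; `λ_j = cos(2πj/n)` is the exact spectrum of its nearest-neighbour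
update and the source of the `n²` relaxation-time scaling quoted for one-dimensional toy models.
-/

namespace Literature.Probability.MarkovChains

open Finset Matrix

variable (n : ℕ) [NeZero n]

/-- **Simple random walk on the `n`-cycle** `ℤ_n`: `P(k, k+1) = P(k, k−1) = ½` (for `n = 2` the two
moves coincide and `P(k, k+1) = 1`; for `n = 1`, `P(0,0) = 1`). [cite: LevinPeres2017, §12.3.1
(random walk on `W_n` with increment distribution uniform on `{ω, ω⁻¹}`)] -/
noncomputable def cycleWalk : Matrix (ZMod n) (ZMod n) ℝ :=
  Matrix.of fun k l => (if l = k + 1 then (1 / 2 : ℝ) else 0) + (if l = k - 1 then (1 / 2 : ℝ) else 0)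

/-- **Eq. (12.18)**: `f_j(ω^k) = cos(2πjk/n)`. [cite: LevinPeres2017, §12.3.1 eq. (12.18)] -/
noncomputable def cycleEigenfun (j : ℕ) : ZMod n → ℝ :=
  fun k => Real.cos (2 * Real.pi * j * k.val / n)

variable {n}

omit [NeZero n] in
/-- Entries of the walk. [cite: LevinPeres2017, §12.3.1] -/
theorem cycleWalk_apply (k l : ZMod n) :
    cycleWalk n k l = (if l = k + 1 then (1 / 2 : ℝ) else 0) + (if l = k - 1 then (1 / 2 : ℝ) else 0) :=
  rfl

/-- **`(Pf)(ω^k) = [f(ω^{k−1}) + f(ω^{k+1})]/2`**. [cite: LevinPeres2017, §12.3.1 (the display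
`λf(ω^k) = Pf(ω^k) = [f(ω^{k−1}) + f(ω^{k+1})]/2`)] -/
theorem cycleWalk_mulVec (f : ZMod n → ℝ) (k : ZMod n) :
    (cycleWalk n *ᵥ f) k = (f (k + 1) + f (k - 1)) / 2 := by
  simp only [mulVec, dotProduct, cycleWalk_apply, add_mul, sum_add_distrib, ite_mul, zero_mul]
  rw [sum_ite_eq' univ (k + 1), sum_ite_eq' univ (k - 1)]
  simp only [mem_univ, if_true]
  ring

/-- Row sums `½ + ½ = 1` and non-negative entries: the walk is a transition matrix.
[cite: LevinPeres2017, §12.3.1 with §1.1] -/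
theorem cycleWalk_isRowStochastic : IsRowStochastic (cycleWalk n) := by
  refine ⟨fun k l => ?_, fun k => ?_⟩
  · rw [cycleWalk_apply]
    exact add_nonneg (by split_ifs <;> norm_num) (by split_ifs <;> norm_num)
  · have h := cycleWalk_mulVec (n := n) (fun _ => (1 : ℝ)) k
    simp only [mulVec, dotProduct, mul_one] at h
    rw [h]
    norm_num

omit [NeZero n] in
/-- The walk is symmetric: `P(k,l) = P(l,k)`. [cite: LevinPeres2017, §12.3.1 (increments uniform on
`{ω, ω⁻¹}`, a symmetric distribution) with §2.6.1 Prop. 2.14] -/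
theorem cycleWalk_symm (k l : ZMod n) : cycleWalk n k l = cycleWalk n l k := by
  rw [cycleWalk_apply, cycleWalk_apply]
  have h1 : (l = k + 1) ↔ (k = l - 1) := by constructor <;> intro h <;> subst h <;> ring
  have h2 : (l = k - 1) ↔ (k = l + 1) := by constructor <;> intro h <;> subst h <;> ring
  simp only [h1, h2]
  ring

omit [NeZero n] in
/-- The uniform distribution is reversible (hence stationary) for the walk on the cycle.
[cite: LevinPeres2017, §2.6.1 Prop. 2.14 (symmetric increment distribution) with §12.3.1] -/
theorem cycleWalk_detailedBalance_uniform :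
    DetailedBalance (fun _ : ZMod n => (1 : ℝ) / n) (cycleWalk n) := fun k l => by
  rw [cycleWalk_symm k l]

/-! ## The eigenfunctions `f_j` -/

/-- Periodicity bookkeeping: `cos(2πj·(m mod n)/n) = cos(2πj·m/n)`. [cite: LevinPeres2017, §12.3.1
("Since `ωⁿ = 1`, we have `ω^jω^k = ω^{k+j mod n}`")] -/
theorem cos_two_pi_mul_mod (j m : ℕ) :
    Real.cos (2 * Real.pi * j * ((m % n : ℕ) : ℝ) / n) = Real.cos (2 * Real.pi * j * m / n) := by
  have hn : (n : ℝ) ≠ 0 := Nat.cast_ne_zero.mpr (NeZero.ne n)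
  have hdecomp : (m : ℝ) = n * ((m / n : ℕ) : ℝ) + ((m % n : ℕ) : ℝ) := by
    exact_mod_cast (Nat.div_add_mod m n).symm
  have : 2 * Real.pi * j * ((m % n : ℕ) : ℝ) / n =
      2 * Real.pi * j * m / n - ((j * (m / n) : ℕ) : ℝ) * (2 * Real.pi) := by
    rw [hdecomp]
    push_cast
    field_simp
    ring
  rw [this, Real.cos_sub_nat_mul_two_pi]

/-- `f_j(ω^{k+1}) = cos(2πjk/n + 2πj/n)`. [cite: LevinPeres2017, §12.3.1 eq. (12.16)
(`φ_j(ω^{k+1}) = ω^{jk+j}`)] -/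
theorem cycleEigenfun_add_one (j : ℕ) (k : ZMod n) :
    cycleEigenfun n j (k + 1) = Real.cos (2 * Real.pi * j * k.val / n + 2 * Real.pi * j / n) := by
  unfold cycleEigenfun
  rw [ZMod.val_add, ZMod.val_one_eq_one_mod, Nat.add_mod_mod, cos_two_pi_mul_mod]
  push_cast
  ring_nf

/-- `f_j(ω^{k−1}) = cos(2πjk/n − 2πj/n)`. [cite: LevinPeres2017, §12.3.1 eq. (12.16)
(`φ_j(ω^{k−1}) = ω^{jk−j}`)] -/
theorem cycleEigenfun_sub_one (j : ℕ) (k : ZMod n) :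
    cycleEigenfun n j (k - 1) = Real.cos (2 * Real.pi * j * k.val / n - 2 * Real.pi * j / n) := by
  obtain ⟨m, hm⟩ := Nat.exists_eq_succ_of_ne_zero (NeZero.ne n)
  subst hm
  unfold cycleEigenfun
  rw [sub_eq_add_neg, ZMod.val_add, ZMod.val_neg_one, cos_two_pi_mul_mod]
  have hn : ((m.succ : ℕ) : ℝ) ≠ 0 := Nat.cast_ne_zero.mpr (Nat.succ_ne_zero m)
  have : 2 * Real.pi * j * ((k.val + m : ℕ) : ℝ) / (m.succ : ℕ) =
      2 * Real.pi * j * k.val / (m.succ : ℕ) - 2 * Real.pi * j / (m.succ : ℕ) + (j : ℕ) * (2 * Real.pi) := by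
    push_cast
    field_simp
    ring
  rw [this, Real.cos_add_nat_mul_two_pi]

/-- **EQS. (12.16)–(12.18): `f_j` is an eigenfunction of `P` with eigenvalue `λ_j = cos(2πj/n)`**,
`P f_j = cos(2πj/n) f_j` (`cos(θ + b) + cos(θ − b) = 2 cos b cos θ`).
[cite: LevinPeres2017, §12.3.1 eqs. (12.16)–(12.18)] -/
theorem LevinPeres2017_eq_12_18 (j : ℕ) :
    cycleWalk n *ᵥ cycleEigenfun n j = Real.cos (2 * Real.pi * j / n) • cycleEigenfun n j := by
  funext k
  rw [cycleWalk_mulVec, Pi.smul_apply, smul_eq_mul, cycleEigenfun_add_one, cycleEigenfun_sub_one]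
  unfold cycleEigenfun
  rw [Real.cos_add, Real.cos_sub]
  ring

omit [NeZero n] in
/-- `f_j(ω⁰) = 1`, so `f_j ≠ 0`. [cite: LevinPeres2017, §12.3.1 eq. (12.18)] -/
theorem cycleEigenfun_zero (j : ℕ) : cycleEigenfun n j 0 = 1 := by
  unfold cycleEigenfun
  rw [ZMod.val_zero]
  simp

/-- **When `n = 2m` is even, `cos(2πm/n) = −1` is an eigenvalue** (eigenfunction `f_m`, `f_m(ω⁰) = 1`),
"so `γ⋆ = 0`.  The walk in this case is periodic." [cite: LevinPeres2017, §12.3.1 (last paragraph)] -/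
theorem LevinPeres2017_cycle_even (m : ℕ) [NeZero (2 * m)] :
    cycleWalk (2 * m) *ᵥ cycleEigenfun (2 * m) m = (-1 : ℝ) • cycleEigenfun (2 * m) m ∧
      cycleEigenfun (2 * m) m 0 = 1 := by
  refine ⟨?_, cycleEigenfun_zero m⟩
  rw [LevinPeres2017_eq_12_18]
  congr 1
  have hm : (m : ℝ) ≠ 0 := by
    have h := NeZero.ne (2 * m)
    exact_mod_cast fun hm => h (by rw [hm, mul_zero])
  have : 2 * Real.pi * (m : ℕ) / ((2 * m : ℕ) : ℝ) = Real.pi := by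
    push_cast
    field_simp
  rw [this, Real.cos_pi]

end Literature.Probability.MarkovChains
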